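import Summits.KontsevichZagierPeriods.KontsevichZagierPeriods.Theorems.SoloInformedCylinderNL
import HarnessLib
import HarnessLib.Audit

/-!
# SoloInformed — separable bands with a rational `y`-primitive; cylinders

Solo programme `solo-KontsevichZagierPeriods-informed`, session s112, file 38.

File 37 with a `K`-RATIONAL primitive in `y`: `G = G_n/G_d`, `G_d ≠ 0` on the closed band.  The
integrand is `f(x)·(G_n' G_d − G_n G_d')(y)/G_d(y)²` and the move of rule (3) lands on
`[D, f(x)(G(B x) − G(A x))]`, `K`-rational in `x` — e.g. `∫∫_{D×[0,1]} f(x) dy dx/(1+y)²`.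
Corollary (file 37 with `G = X`): the cylinder `[D × [A x, B x], f(x)]` is ONE move away from
`[D, (B x − A x) f(x)]` — Fubini for integrands constant in `y` is a KZ move.  THEOREMS
`soloInformed_kzp_cylinderNLRat`, `soloInformed_kzp_cylinder_const`.  Unconditional.
(With `G_d` vanishing somewhere on the band, or `G = log`, one leaves weight one: dilogarithms.)

References: M. Kontsevich, D. Zagier, *Periods* (2001), §1.2 rule (3); this work.
-/

noncomputable section

open scoped BigOperators Polynomial

namespace Summit.KontsevichZagierPeriods.KontsevichZagierPeriods.Theorems

open Set MeasureTheory
open Literature.ModelTheory.ExponentialFields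
open Literature.NumberTheory.Transcendental Literature.NumberTheory.Transcendental.KZ

/-- **Separable band move, rational primitive.** `[band, f(x)·(G_n/G_d)'(y)] − [D, f(x)(G(Bx) − G(Ax))]`
is a relation (`G = G_n/G_d`, `G_d ≠ 0` on the closed band). [Kontsevich–Zagier 2001, §1.2 rule (3)] -/
theorem soloInformed_cylinderNLRat_mem_relations (r : IntegralRep 2) (r₁ : IntegralRep 1)
    (A B Gn Gd Pf Qf : (algebraicClosure ℚ ℝ)[X])
    (hAB : ∀ x ∈ r₁.domain, (Polynomial.aeval (x 0) A : ℝ) ≤ Polynomial.aeval (x 0) B)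
    (hQf : ∀ x ∈ r₁.domain, (Polynomial.aeval (x 0) Qf : ℝ) ≠ 0)
    (hGd : ∀ x ∈ r₁.domain, ∀ t ∈ Icc (Polynomial.aeval (x 0) A : ℝ) (Polynomial.aeval (x 0) B),
      (Polynomial.aeval t Gd : ℝ) ≠ 0)
    (hdom : r.domain = {z | (Fin.init z : Fin 1 → ℝ) ∈ r₁.domain ∧
      (Polynomial.aeval (Fin.init z 0) A : ℝ) ≤ z (Fin.last 1) ∧
      z (Fin.last 1) ≤ Polynomial.aeval (Fin.init z 0) B})
    (hf : ∀ z ∈ r.domain, r.integrand z = (Polynomial.aeval (z 0) Pf : ℝ) / Polynomial.aeval (z 0) Qf *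
      (((Polynomial.aeval (z (Fin.last 1)) (Polynomial.derivative Gn) : ℝ) *
          Polynomial.aeval (z (Fin.last 1)) Gd -
        Polynomial.aeval (z (Fin.last 1)) Gn * Polynomial.aeval (z (Fin.last 1)) (Polynomial.derivative Gd)) /
        (Polynomial.aeval (z (Fin.last 1)) Gd) ^ 2))
    (hf₁ : ∀ x ∈ r₁.domain, r₁.integrand x = (Polynomial.aeval (x 0) Pf : ℝ) / Polynomial.aeval (x 0) Qf *
      ((Polynomial.aeval (Polynomial.aeval (x 0) B : ℝ) Gn : ℝ) / Polynomial.aeval (Polynomial.aeval (x 0) B : ℝ) Gd -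
        (Polynomial.aeval (Polynomial.aeval (x 0) A : ℝ) Gn : ℝ) / Polynomial.aeval (Polynomial.aeval (x 0) A : ℝ) Gd)) :
    of r - of r₁ ∈ relations := by
  have hK := soloInformed_isAlgebraic_algebraMap_K
  have hsnoc : ∀ (x : Fin 1 → ℝ) (t : ℝ),
      (Fin.snoc x t : Fin 2 → ℝ) 0 = x 0 ∧ (Fin.snoc x t : Fin 2 → ℝ) (Fin.last 1) = t := fun x t =>
    ⟨Fin.snoc_castSucc (α := fun _ : Fin 2 => ℝ) (p := x) (x := t) (i := 0),
      Fin.snoc_last (α := fun _ : Fin 2 => ℝ) (x := t) (p := x)⟩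
  have haX : ∀ {n : ℕ} (P : (algebraicClosure ℚ ℝ)[X]) (i : Fin n)
      (z : Fin n → ℝ), (MvPolynomial.aeval z (Polynomial.aeval (MvPolynomial.X i :
        MvPolynomial (Fin n) (algebraicClosure ℚ ℝ)) P) : ℝ) = Polynomial.aeval (z i) P :=
    fun P i z => by rw [← Polynomial.aeval_algHom_apply, MvPolynomial.aeval_X]
  set F : (Fin 2 → ℝ) → ℝ := fun z => (Polynomial.aeval (z 0) Pf : ℝ) / Polynomial.aeval (z 0) Qf *
    ((Polynomial.aeval (z (Fin.last 1)) Gn : ℝ) / Polynomial.aeval (z (Fin.last 1)) Gd) with hFdef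
  set a : (Fin 1 → ℝ) → ℝ := fun x => Polynomial.aeval (x 0) A with hadef
  set b : (Fin 1 → ℝ) → ℝ := fun x => Polynomial.aeval (x 0) B with hbdef
  have hFsnoc : ∀ (x : Fin 1 → ℝ) (t : ℝ), F (Fin.snoc x t) =
      (Polynomial.aeval (x 0) Pf : ℝ) / Polynomial.aeval (x 0) Qf *
        ((Polynomial.aeval t Gn : ℝ) / Polynomial.aeval t Gd) := fun x t => by
    rw [hFdef]
    show (Polynomial.aeval ((Fin.snoc x t : Fin 2 → ℝ) 0) Pf : ℝ) /
        Polynomial.aeval ((Fin.snoc x t : Fin 2 → ℝ) 0) Qf *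
        ((Polynomial.aeval ((Fin.snoc x t : Fin 2 → ℝ) (Fin.last 1)) Gn : ℝ) /
          Polynomial.aeval ((Fin.snoc x t : Fin 2 → ℝ) (Fin.last 1)) Gd) = _
    rw [(hsnoc x t).1, (hsnoc x t).2]
  have hmem : ∀ x ∈ r₁.domain, ∀ t, a x ≤ t → t ≤ b x → (Fin.snoc x t : Fin 2 → ℝ) ∈ r.domain :=
    fun x hx t h1 h2 => by
    rw [hdom]
    refine ⟨?_, ?_, ?_⟩
    · rw [Fin.init_snoc]; exact hx
    · rw [Fin.init_snoc, (hsnoc x t).2]; exact h1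
    · rw [Fin.init_snoc, (hsnoc x t).2]; exact h2
  -- `G_d ≠ 0` on the band, read in the coordinates of `z`
  have hGdz : ∀ z ∈ r.domain, (Polynomial.aeval (z (Fin.last 1)) Gd : ℝ) ≠ 0 := fun z hz => by
    have hz' := hz
    rw [hdom] at hz'
    exact hGd _ hz'.1 _ ⟨hz'.2.1, hz'.2.2⟩
  have hF : IsSemialgebraicFunOn ℚ r.domain F := by
    have hQ : ∀ z ∈ r.domain, (MvPolynomial.aeval z (Polynomial.aeval (MvPolynomial.X 0 :
        MvPolynomial (Fin 2) (algebraicClosure ℚ ℝ)) Qf * Polynomial.aeval (MvPolynomial.X (Fin.last 1) :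
        MvPolynomial (Fin 2) (algebraicClosure ℚ ℝ)) Gd) : ℝ) ≠ 0 := fun z hz => by
      rw [map_mul, haX, haX]
      have hz' := hz
      rw [hdom] at hz'
      exact mul_ne_zero (hQf _ hz'.1) (hGdz z hz)
    refine (soloInformed_isSemialgebraicFunOn_aevalK_div hK r.isSemialgebraic_domain
      (Polynomial.aeval (MvPolynomial.X 0 : MvPolynomial (Fin 2) (algebraicClosure ℚ ℝ)) Pf *
        Polynomial.aeval (MvPolynomial.X (Fin.last 1) : MvPolynomial (Fin 2) (algebraicClosure ℚ ℝ)) Gn)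
      (Polynomial.aeval (MvPolynomial.X 0 : MvPolynomial (Fin 2) (algebraicClosure ℚ ℝ)) Qf *
        Polynomial.aeval (MvPolynomial.X (Fin.last 1) : MvPolynomial (Fin 2) (algebraicClosure ℚ ℝ)) Gd)
      hQ).congr fun z _ => ?_
    simp only [map_mul, haX, hFdef]
    rw [div_mul_div_comm]
  have ha : IsSemialgebraicFunOn ℚ r₁.domain a :=
    (soloInformed_isSemialgebraicFunOn_aevalK hK r₁.isSemialgebraic_domain
      (Polynomial.aeval (MvPolynomial.X 0 : MvPolynomial (Fin 1) (algebraicClosure ℚ ℝ)) A)).congr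
      fun x _ => by simp only [haX, hadef]
  have hb : IsSemialgebraicFunOn ℚ r₁.domain b :=
    (soloInformed_isSemialgebraicFunOn_aevalK hK r₁.isSemialgebraic_domain
      (Polynomial.aeval (MvPolynomial.X 0 : MvPolynomial (Fin 1) (algebraicClosure ℚ ℝ)) B)).congr
      fun x _ => by simp only [haX, hbdef]
  refine newtonLeibnizRel_subset_relations ⟨1, r, r₁, a, b, F, hF, ha, hb, hAB, ?_, ?_, ?_, ?_, rfl⟩
  · rw [hdom]
  · intro x hx
    have hc : ContinuousOn (fun t : ℝ => (Polynomial.aeval (x 0) Pf : ℝ) / Polynomial.aeval (x 0) Qf *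
        ((Polynomial.aeval t Gn : ℝ) / Polynomial.aeval t Gd)) (Icc (a x) (b x)) :=
      continuousOn_const.mul ((Polynomial.continuous_aeval Gn).continuousOn.div
        (Polynomial.continuous_aeval Gd).continuousOn fun t ht => hGd x hx t ht)
    exact hc.congr fun t _ => hFsnoc x t
  · intro x hx t ht
    have hfun : (fun s : ℝ => F (Fin.snoc x s)) = fun s => (Polynomial.aeval (x 0) Pf : ℝ) /
        Polynomial.aeval (x 0) Qf * ((Polynomial.aeval s Gn : ℝ) / Polynomial.aeval s Gd) :=
      funext fun s => hFsnoc x s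
    rw [hfun, hf _ (hmem x hx t ht.1.le ht.2.le), (hsnoc x t).1, (hsnoc x t).2]
    exact ((Polynomial.hasDerivAt_aeval Gn t).div (Polynomial.hasDerivAt_aeval Gd t)
      (hGd x hx t ⟨ht.1.le, ht.2.le⟩)).const_mul _
  · intro x hx
    rw [hf₁ x hx, hFsnoc, hFsnoc]
    ring

/-- **The period conjecture for separable bands with rational `y`-primitive.**  With the data above:
`[D, f(x)(G(Bx) − G(Ax))]` and `[band, f(x) G'(y)]` lie in the span of points and segments,
`Equivalent r r₁`, and `r` is KZ-equivalent to every elementary sum, every rational representation of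
dimension `≤ 1` and every span member of the same value.  Unconditional.
[Kontsevich–Zagier 2001, §1.2; this work] -/
theorem soloInformed_kzp_cylinderNLRat (r : IntegralRep 2) (r₁ : IntegralRep 1)
    (A B Gn Gd Pf Qf : (algebraicClosure ℚ ℝ)[X])
    (hAB : ∀ x ∈ r₁.domain, (Polynomial.aeval (x 0) A : ℝ) ≤ Polynomial.aeval (x 0) B)
    (hQf : ∀ x ∈ r₁.domain, (Polynomial.aeval (x 0) Qf : ℝ) ≠ 0)
    (hGd : ∀ x ∈ r₁.domain, ∀ t ∈ Icc (Polynomial.aeval (x 0) A : ℝ) (Polynomial.aeval (x 0) B),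
      (Polynomial.aeval t Gd : ℝ) ≠ 0)
    (hdom : r.domain = {z | (Fin.init z : Fin 1 → ℝ) ∈ r₁.domain ∧
      (Polynomial.aeval (Fin.init z 0) A : ℝ) ≤ z (Fin.last 1) ∧
      z (Fin.last 1) ≤ Polynomial.aeval (Fin.init z 0) B})
    (hf : ∀ z ∈ r.domain, r.integrand z = (Polynomial.aeval (z 0) Pf : ℝ) / Polynomial.aeval (z 0) Qf *
      (((Polynomial.aeval (z (Fin.last 1)) (Polynomial.derivative Gn) : ℝ) *
          Polynomial.aeval (z (Fin.last 1)) Gd -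
        Polynomial.aeval (z (Fin.last 1)) Gn * Polynomial.aeval (z (Fin.last 1)) (Polynomial.derivative Gd)) /
        (Polynomial.aeval (z (Fin.last 1)) Gd) ^ 2))
    (hf₁ : ∀ x ∈ r₁.domain, r₁.integrand x = (Polynomial.aeval (x 0) Pf : ℝ) / Polynomial.aeval (x 0) Qf *
      ((Polynomial.aeval (Polynomial.aeval (x 0) B : ℝ) Gn : ℝ) / Polynomial.aeval (Polynomial.aeval (x 0) B : ℝ) Gd -
        (Polynomial.aeval (Polynomial.aeval (x 0) A : ℝ) Gn : ℝ) / Polynomial.aeval (Polynomial.aeval (x 0) A : ℝ) Gd)) :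
    of r₁ ∈ soloInformedSegSpan ∧ of r ∈ soloInformedSegSpan ∧ Equivalent r r₁ ∧
    (∀ r₂ : IntegralRep 1, SoloInformedIsKElementarySumOne r₂ → r.value = r₂.value → Equivalent r r₂) ∧
    (∀ {n : ℕ} (hn : n ≤ 1) (r₀ : IntegralRep n), r₀.IsRational → r.value = r₀.value →
      Equivalent r r₀) ∧
    (∀ {k : ℕ} (r₂ : IntegralRep k), of r₂ ∈ soloInformedSegSpan → r.value = r₂.value →
      Equivalent r r₂) := by
  have hrel := soloInformed_cylinderNLRat_mem_relations r r₁ A B Gn Gd Pf Qf hAB hQf hGd hdom hf hf₁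
  have hA : ∀ x ∈ r₁.domain, (Polynomial.aeval (Polynomial.aeval (x 0) A : ℝ) Gd : ℝ) ≠ 0 := fun x hx =>
    hGd x hx _ (left_mem_Icc.2 (hAB x hx))
  have hB : ∀ x ∈ r₁.domain, (Polynomial.aeval (Polynomial.aeval (x 0) B : ℝ) Gd : ℝ) ≠ 0 := fun x hx =>
    hGd x hx _ (right_mem_Icc.2 (hAB x hx))
  have h₁ : of r₁ ∈ soloInformedSegSpan :=
    soloInformed_segSpan_of_isKRationalOne r₁ ⟨Pf * (Gn.comp B * Gd.comp A - Gn.comp A * Gd.comp B),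
      Qf * (Gd.comp B * Gd.comp A), fun x hx => by
        rw [map_mul, map_mul, Polynomial.aeval_comp, Polynomial.aeval_comp]
        exact mul_ne_zero (hQf x hx) (mul_ne_zero (hB x hx) (hA x hx)), fun x hx => by
      show r₁.integrand x = (Polynomial.aeval (x 0) (Pf * (Gn.comp B * Gd.comp A - Gn.comp A * Gd.comp B)) : ℝ) /
        Polynomial.aeval (x 0) (Qf * (Gd.comp B * Gd.comp A))
      rw [hf₁ x hx]
      simp only [map_mul, map_sub, Polynomial.aeval_comp]
      rw [div_sub_div _ _ (hB x hx) (hA x hx), div_mul_div_comm]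
      ring⟩
  have h : of r ∈ soloInformedSegSpan := soloInformed_mem_segSpan_of_sub_mem hrel h₁
  have hv : r.value = r₁.value := by
    have h0 : eval (of r - of r₁) = 0 := relations_le_ker_eval_holds hrel
    rw [map_sub, eval_of, eval_of] at h0
    exact sub_eq_zero.1 h0
  exact ⟨h₁, h, soloInformed_equivalent_of_mem_segSpan h h₁ hv,
    fun r₂ hr₂ hv' => soloInformed_equivalent_of_mem_segSpan h
      (soloInformed_segSpan_of_isKElementarySumOne r₂ hr₂) hv',
    fun hn r₀ hr₀ hv' => soloInformed_equivalent_of_mem_segSpan h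
      (soloInformed_of_mem_segSpan_of_isRational hn r₀ hr₀) hv',
    fun r₂ hr₂ hv' => soloInformed_equivalent_of_mem_segSpan h hr₂ hv'⟩

/-- **Fubini for `y`-constant integrands is one KZ move:** `[{x ∈ D, A x ≤ y ≤ B x}, f(x)]` and
`[D, (B x − A x) f(x)]` (`f = P_f/Q_f` over `K`) are KZ-equivalent, and both lie in the span of points
and segments. [Kontsevich–Zagier 2001, §1.2 rule (3); this work] -/
theorem soloInformed_kzp_cylinder_const (r : IntegralRep 2) (r₁ : IntegralRep 1)
    (A B Pf Qf : (algebraicClosure ℚ ℝ)[X])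
    (hAB : ∀ x ∈ r₁.domain, (Polynomial.aeval (x 0) A : ℝ) ≤ Polynomial.aeval (x 0) B)
    (hQf : ∀ x ∈ r₁.domain, (Polynomial.aeval (x 0) Qf : ℝ) ≠ 0)
    (hdom : r.domain = {z | (Fin.init z : Fin 1 → ℝ) ∈ r₁.domain ∧
      (Polynomial.aeval (Fin.init z 0) A : ℝ) ≤ z (Fin.last 1) ∧
      z (Fin.last 1) ≤ Polynomial.aeval (Fin.init z 0) B})
    (hf : ∀ z ∈ r.domain, r.integrand z = (Polynomial.aeval (z 0) Pf : ℝ) / Polynomial.aeval (z 0) Qf)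
    (hf₁ : ∀ x ∈ r₁.domain, r₁.integrand x = (Polynomial.aeval (x 0) Pf : ℝ) / Polynomial.aeval (x 0) Qf *
      ((Polynomial.aeval (x 0) B : ℝ) - Polynomial.aeval (x 0) A)) :
    of r ∈ soloInformedSegSpan ∧ Equivalent r r₁ ∧
    (∀ {k : ℕ} (r₂ : IntegralRep k), of r₂ ∈ soloInformedSegSpan → r.value = r₂.value →
      Equivalent r r₂) := by
  have h := soloInformed_kzp_cylinderNL r r₁ A B Polynomial.X Pf Qf hAB hQf hdom (fun z hz => by
    rw [hf z hz, Polynomial.derivative_X, map_one, mul_one]) (fun x hx => by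
    rw [hf₁ x hx, Polynomial.aeval_X, Polynomial.aeval_X])
  have hs := soloInformed_segSpan_of_cylinderNL r r₁ A B Polynomial.X Pf Qf hAB hQf hdom (fun z hz => by
    rw [hf z hz, Polynomial.derivative_X, map_one, mul_one]) (fun x hx => by
    rw [hf₁ x hx, Polynomial.aeval_X, Polynomial.aeval_X])
  exact ⟨hs.2, h.1, fun r₂ hr₂ hv => h.2.2.2.2 r₂ hr₂ hv⟩

end Summit.KontsevichZagierPeriods.KontsevichZagierPeriods.Theorems
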